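/-
Copyright: the b2b-balaban T⁴-continuum CRUX team, row NE7b OWNER lineage `t4-ne7b-p1` (gen 143). Project licence.
-/
import Summits.QuantumFields.BalabanUV.T4Continuum.Spine.NE7b.SupFivePointMinMax
import Summits.QuantumFields.BalabanUV.T4Continuum.Spine.NE7b.SupFivePointGreedyRowSum

/-!
# THE FIVE SLOT SUMS OF THE THRESHOLD MAJORANT ARE VOLUME-UNIFORM (SCOPING (d14)(2)(iii), first file of gen 143).  (539) wrote the order-5 entry
# majorant as `C·t⋆⁴`, `t⋆ = min_S max_{e crossing S} q_e` (fifteen cuts, WRITTEN OUT), and proved `t⋆⁴ ≤ G_r` for each root `r = 1,…,5`; (538)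
# proved `Σ_{four non-root sites} G₁ ≤ 576·S⁴` from row AND column sums of the weight.  Here the two are composed ONCE AND FOR ALL for a
# site-indexed SYMMETRIC weight `q_{ab} := w x_a x_b` (`w ≥ 0`, `w x y = w y x`, rows `≤ S`): for every slot `r`,
#   `Σ_{x_j : j ≠ r} t⋆(w; x₁,…,x₅)⁴ ≤ 576·S⁴`   uniformly in the fixed site `x_r` and the volume
# ((538) `l_1` rooted at `x_r`; the relabelled polynomial `G_r` of (539) writes the root pairs ascending, `q_{jr} = w x_j x_r` for `j < r`, and
# (538)'s `l_1` reads them as `w x_r x_j` — the only place symmetry is used).  With (557) (`|u₅| ≤ (C₁+C₂)·t⋆⁴` at `q = r⁻¹`) these are the five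
# fixed-slot letters of the fifth cumulant's entry majorant; the whitened instantiation follows (row NE7b, node U5c; (538), (539) BY NAME;
# Mathlib only through them; [folklore])

Cell `pub-balaban`, sub-cell `t4`, spine estimate NE7b (`T4WeightBudget.RelWeightBound`; the cell's OWN estimate — NOT PRINTED in
[Bałaban 1983–89], NOT PROVED).  Crux-route work under `Spine/NE7b/` by the row OWNER (`t4-ne7b-p1` gen 143, file (558)) under FREEZE
(0)'s crux-prover clause; NOTHING of Bałaban's is named as a Lean object, valued or asserted; no `T4Continuum/Support` leaf typed; no
`def`, no notation (`t⋆` WRITTEN OUT); zero `sorry`.  Imports (BY NAME): the OWNER's (539) `…SupFivePointMinMax` (`minmax_pow4_le_greedy_1 … _5`),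
(538) `…SupFivePointGreedyRowSum` (`l_1`).

WHAT IS PROVED ([folklore]): §1 `colsum_of_symm`; §2 **`threshold_pow4_slot_1 … threshold_pow4_slot_5`**; §3 toy.

HONEST (what this is NOT).  Site-sum combinatorics only; the whitened fifth cumulant's entry bound (`q = r⁻¹`, (557) instantiated with (466), (465),
(505)), its row letter and the order-5 entries∕form∕kernel letter are the next files; scalar skeleton ((A3), NC-NE7b-α UNRULED); nothing of Bałaban's
asserted.  BY-NAME EFFECT ON THE WALL: NONE.  NE7b NOT PRINTED ∕ NOT PROVED; spine PROVED 0∕9; rung (B)+1 — the programme's measures remain FINITE-torus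
statements; NOT the mass gap, NOT Clay.  HONEST DEPENDENCY: continuum YM on T⁴ ⇐ BetaPertH ∧ nine spine estimates (0∕9 proved); BetaPertH ⇐ (D1) ∧
(D4) ∧ CAP+tail; G-an2-4 gates asym, D1 and NE2∕3∕4.
-/

set_option autoImplicit false

namespace Summit.QuantumFields.BalabanUV.T4Continuum.NE7b.SupFivePointThresholdSlotSums

open Finset
open scoped BigOperators
open SupFivePointMinMax (minmax_pow4_le_greedy_1 minmax_pow4_le_greedy_2 minmax_pow4_le_greedy_3 minmax_pow4_le_greedy_4
  minmax_pow4_le_greedy_5)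
open SupFivePointGreedyRowSum (l_1)

variable {ι : Type} [Fintype ι]

/-! ## §1. Column sums of a symmetric weight -/

/-- A symmetric weight's column sums are its row sums. [folklore] -/
theorem colsum_of_symm {w : ι → ι → ℝ} {S : ℝ} (hws : ∀ x y, w x y = w y x) (hS : ∀ x, ∑ y, w x y ≤ S) (y : ι) : ∑ x, w x y ≤ S :=
  calc ∑ x, w x y = ∑ x, w y x := Finset.sum_congr rfl fun x _ => hws x y
    _ ≤ S := hS y

/-! ## §2. The five slot sums of `t⋆⁴` -/

section Slots

variable {w : ι → ι → ℝ} {S : ℝ}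

/-- **SLOT `1`: `Σ_{x₂,x₃,x₄,x₅} t⋆(w;x₁,…,x₅)⁴ ≤ 576·S⁴`** uniformly in `x₁` and the volume ((539) `minmax_pow4_le_greedy_1`, then
(538) `l_1` rooted at `x₁`; no pair flipped). [folklore] -/
theorem threshold_pow4_slot_1 (hw0 : ∀ x y, 0 ≤ w x y) (hws : ∀ x y, w x y = w y x) (hS0 : 0 ≤ S) (hS : ∀ x, ∑ y, w x y ≤ S) (x₁ : ι) :
    ∑ x₂, ∑ x₃, ∑ x₄, ∑ x₅, (min (max (w x₁ x₂) (max (w x₁ x₃) (max (w x₁ x₄) (w x₁ x₅)))) (min (max (w x₁ x₃) (max (w x₂ x₃) (max (w x₁ x₄) (max (w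
        x₂ x₄) (max (w x₁ x₅) (w x₂ x₅)))))) (min (max (w x₁ x₂) (max (w x₂ x₃) (max (w x₁ x₄) (max (w x₃ x₄) (max (w x₁ x₅) (w x₃ x₅)))))) (min (max
        (w x₁ x₂) (max (w x₂ x₄) (max (w x₁ x₃) (max (w x₃ x₄) (max (w x₁ x₅) (w x₄ x₅)))))) (min (max (w x₁ x₂) (max (w x₂ x₅) (max (w x₁ x₃) (max
        (w x₃ x₅) (max (w x₁ x₄) (w x₄ x₅)))))) (min (max (w x₁ x₄) (max (w x₂ x₄) (max (w x₃ x₄) (max (w x₁ x₅) (max (w x₂ x₅) (w x₃ x₅)))))) (min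
        (max (w x₁ x₃) (max (w x₂ x₃) (max (w x₃ x₄) (max (w x₁ x₅) (max (w x₂ x₅) (w x₄ x₅)))))) (min (max (w x₁ x₃) (max (w x₂ x₃) (max (w x₃ x₅)
        (max (w x₁ x₄) (max (w x₂ x₄) (w x₄ x₅)))))) (min (max (w x₁ x₂) (max (w x₂ x₃) (max (w x₂ x₄) (max (w x₁ x₅) (max (w x₃ x₅) (w x₄ x₅))))))
        (min (max (w x₁ x₂) (max (w x₂ x₃) (max (w x₂ x₅) (max (w x₁ x₄) (max (w x₃ x₄) (w x₄ x₅)))))) (min (max (w x₁ x₂) (max (w x₂ x₄) (max (w x₂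
        x₅) (max (w x₁ x₃) (max (w x₃ x₄) (w x₃ x₅)))))) (min (max (w x₁ x₅) (max (w x₂ x₅) (max (w x₃ x₅) (w x₄ x₅)))) (min (max (w x₁ x₄) (max (w
        x₂ x₄) (max (w x₃ x₄) (w x₄ x₅)))) (min (max (w x₁ x₃) (max (w x₂ x₃) (max (w x₃ x₄) (w x₃ x₅)))) (max (w x₁ x₂) (max (w x₂ x₃) (max (w x₂
        x₄) (w x₂ x₅)))))))))))))))))) ^ 4 ≤ 576 * S ^ 4 := by
  refine le_trans (Finset.sum_le_sum fun x₂ _ => Finset.sum_le_sum fun x₃ _ => Finset.sum_le_sum fun x₄ _ => Finset.sum_le_sum fun x₅ _ =>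
    minmax_pow4_le_greedy_1 (q12 := w x₁ x₂) (q13 := w x₁ x₃) (q14 := w x₁ x₄) (q15 := w x₁ x₅) (q23 := w x₂ x₃) (q24 := w x₂ x₄) (q25 := w x₂ x₅)
        (q34 := w x₃ x₄) (q35 := w x₃ x₅) (q45 := w x₄ x₅)
      (hw0 _ _) (hw0 _ _) (hw0 _ _) (hw0 _ _) (hw0 _ _) (hw0 _ _) (hw0 _ _) (hw0 _ _) (hw0 _ _) (hw0 _ _)) ?_
  exact l_1 hw0 hS0 hS (colsum_of_symm hws hS) x₁

/-- **SLOT `2`: `Σ_{x₁,x₃,x₄,x₅} t⋆(w;x₁,…,x₅)⁴ ≤ 576·S⁴`** uniformly in `x₂` and the volume ((539) `minmax_pow4_le_greedy_2`, then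
(538) `l_1` rooted at `x₂`; the root pairs `w x₁ x₂` flipped by symmetry). [folklore] -/
theorem threshold_pow4_slot_2 (hw0 : ∀ x y, 0 ≤ w x y) (hws : ∀ x y, w x y = w y x) (hS0 : 0 ≤ S) (hS : ∀ x, ∑ y, w x y ≤ S) (x₂ : ι) :
    ∑ x₁, ∑ x₃, ∑ x₄, ∑ x₅, (min (max (w x₁ x₂) (max (w x₁ x₃) (max (w x₁ x₄) (w x₁ x₅)))) (min (max (w x₁ x₃) (max (w x₂ x₃) (max (w x₁ x₄) (max (w
        x₂ x₄) (max (w x₁ x₅) (w x₂ x₅)))))) (min (max (w x₁ x₂) (max (w x₂ x₃) (max (w x₁ x₄) (max (w x₃ x₄) (max (w x₁ x₅) (w x₃ x₅)))))) (min (max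
        (w x₁ x₂) (max (w x₂ x₄) (max (w x₁ x₃) (max (w x₃ x₄) (max (w x₁ x₅) (w x₄ x₅)))))) (min (max (w x₁ x₂) (max (w x₂ x₅) (max (w x₁ x₃) (max
        (w x₃ x₅) (max (w x₁ x₄) (w x₄ x₅)))))) (min (max (w x₁ x₄) (max (w x₂ x₄) (max (w x₃ x₄) (max (w x₁ x₅) (max (w x₂ x₅) (w x₃ x₅)))))) (min
        (max (w x₁ x₃) (max (w x₂ x₃) (max (w x₃ x₄) (max (w x₁ x₅) (max (w x₂ x₅) (w x₄ x₅)))))) (min (max (w x₁ x₃) (max (w x₂ x₃) (max (w x₃ x₅)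
        (max (w x₁ x₄) (max (w x₂ x₄) (w x₄ x₅)))))) (min (max (w x₁ x₂) (max (w x₂ x₃) (max (w x₂ x₄) (max (w x₁ x₅) (max (w x₃ x₅) (w x₄ x₅))))))
        (min (max (w x₁ x₂) (max (w x₂ x₃) (max (w x₂ x₅) (max (w x₁ x₄) (max (w x₃ x₄) (w x₄ x₅)))))) (min (max (w x₁ x₂) (max (w x₂ x₄) (max (w x₂
        x₅) (max (w x₁ x₃) (max (w x₃ x₄) (w x₃ x₅)))))) (min (max (w x₁ x₅) (max (w x₂ x₅) (max (w x₃ x₅) (w x₄ x₅)))) (min (max (w x₁ x₄) (max (w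
        x₂ x₄) (max (w x₃ x₄) (w x₄ x₅)))) (min (max (w x₁ x₃) (max (w x₂ x₃) (max (w x₃ x₄) (w x₃ x₅)))) (max (w x₁ x₂) (max (w x₂ x₃) (max (w x₂
        x₄) (w x₂ x₅)))))))))))))))))) ^ 4 ≤ 576 * S ^ 4 := by
  refine le_trans (Finset.sum_le_sum fun x₁ _ => Finset.sum_le_sum fun x₃ _ => Finset.sum_le_sum fun x₄ _ => Finset.sum_le_sum fun x₅ _ =>
    minmax_pow4_le_greedy_2 (q12 := w x₁ x₂) (q13 := w x₁ x₃) (q14 := w x₁ x₄) (q15 := w x₁ x₅) (q23 := w x₂ x₃) (q24 := w x₂ x₄) (q25 := w x₂ x₅)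
        (q34 := w x₃ x₄) (q35 := w x₃ x₅) (q45 := w x₄ x₅)
      (hw0 _ _) (hw0 _ _) (hw0 _ _) (hw0 _ _) (hw0 _ _) (hw0 _ _) (hw0 _ _) (hw0 _ _) (hw0 _ _) (hw0 _ _)) ?_
  refine le_trans (le_of_eq ?_) (l_1 hw0 hS0 hS (colsum_of_symm hws hS) x₂)
  refine Finset.sum_congr rfl fun x₁ _ => Finset.sum_congr rfl fun x₃ _ => Finset.sum_congr rfl fun x₄ _ => Finset.sum_congr rfl fun x₅ _ => ?_
  rw [hws x₁ x₂]

/-- **SLOT `3`: `Σ_{x₁,x₂,x₄,x₅} t⋆(w;x₁,…,x₅)⁴ ≤ 576·S⁴`** uniformly in `x₃` and the volume ((539) `minmax_pow4_le_greedy_3`, then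
(538) `l_1` rooted at `x₃`; the root pairs `w x₁ x₃`, `w x₂ x₃` flipped by symmetry). [folklore] -/
theorem threshold_pow4_slot_3 (hw0 : ∀ x y, 0 ≤ w x y) (hws : ∀ x y, w x y = w y x) (hS0 : 0 ≤ S) (hS : ∀ x, ∑ y, w x y ≤ S) (x₃ : ι) :
    ∑ x₁, ∑ x₂, ∑ x₄, ∑ x₅, (min (max (w x₁ x₂) (max (w x₁ x₃) (max (w x₁ x₄) (w x₁ x₅)))) (min (max (w x₁ x₃) (max (w x₂ x₃) (max (w x₁ x₄) (max (w
        x₂ x₄) (max (w x₁ x₅) (w x₂ x₅)))))) (min (max (w x₁ x₂) (max (w x₂ x₃) (max (w x₁ x₄) (max (w x₃ x₄) (max (w x₁ x₅) (w x₃ x₅)))))) (min (max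
        (w x₁ x₂) (max (w x₂ x₄) (max (w x₁ x₃) (max (w x₃ x₄) (max (w x₁ x₅) (w x₄ x₅)))))) (min (max (w x₁ x₂) (max (w x₂ x₅) (max (w x₁ x₃) (max
        (w x₃ x₅) (max (w x₁ x₄) (w x₄ x₅)))))) (min (max (w x₁ x₄) (max (w x₂ x₄) (max (w x₃ x₄) (max (w x₁ x₅) (max (w x₂ x₅) (w x₃ x₅)))))) (min
        (max (w x₁ x₃) (max (w x₂ x₃) (max (w x₃ x₄) (max (w x₁ x₅) (max (w x₂ x₅) (w x₄ x₅)))))) (min (max (w x₁ x₃) (max (w x₂ x₃) (max (w x₃ x₅)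
        (max (w x₁ x₄) (max (w x₂ x₄) (w x₄ x₅)))))) (min (max (w x₁ x₂) (max (w x₂ x₃) (max (w x₂ x₄) (max (w x₁ x₅) (max (w x₃ x₅) (w x₄ x₅))))))
        (min (max (w x₁ x₂) (max (w x₂ x₃) (max (w x₂ x₅) (max (w x₁ x₄) (max (w x₃ x₄) (w x₄ x₅)))))) (min (max (w x₁ x₂) (max (w x₂ x₄) (max (w x₂
        x₅) (max (w x₁ x₃) (max (w x₃ x₄) (w x₃ x₅)))))) (min (max (w x₁ x₅) (max (w x₂ x₅) (max (w x₃ x₅) (w x₄ x₅)))) (min (max (w x₁ x₄) (max (w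
        x₂ x₄) (max (w x₃ x₄) (w x₄ x₅)))) (min (max (w x₁ x₃) (max (w x₂ x₃) (max (w x₃ x₄) (w x₃ x₅)))) (max (w x₁ x₂) (max (w x₂ x₃) (max (w x₂
        x₄) (w x₂ x₅)))))))))))))))))) ^ 4 ≤ 576 * S ^ 4 := by
  refine le_trans (Finset.sum_le_sum fun x₁ _ => Finset.sum_le_sum fun x₂ _ => Finset.sum_le_sum fun x₄ _ => Finset.sum_le_sum fun x₅ _ =>
    minmax_pow4_le_greedy_3 (q12 := w x₁ x₂) (q13 := w x₁ x₃) (q14 := w x₁ x₄) (q15 := w x₁ x₅) (q23 := w x₂ x₃) (q24 := w x₂ x₄) (q25 := w x₂ x₅)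
        (q34 := w x₃ x₄) (q35 := w x₃ x₅) (q45 := w x₄ x₅)
      (hw0 _ _) (hw0 _ _) (hw0 _ _) (hw0 _ _) (hw0 _ _) (hw0 _ _) (hw0 _ _) (hw0 _ _) (hw0 _ _) (hw0 _ _)) ?_
  refine le_trans (le_of_eq ?_) (l_1 hw0 hS0 hS (colsum_of_symm hws hS) x₃)
  refine Finset.sum_congr rfl fun x₁ _ => Finset.sum_congr rfl fun x₂ _ => Finset.sum_congr rfl fun x₄ _ => Finset.sum_congr rfl fun x₅ _ => ?_
  rw [hws x₁ x₃, hws x₂ x₃]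

/-- **SLOT `4`: `Σ_{x₁,x₂,x₃,x₅} t⋆(w;x₁,…,x₅)⁴ ≤ 576·S⁴`** uniformly in `x₄` and the volume ((539) `minmax_pow4_le_greedy_4`, then
(538) `l_1` rooted at `x₄`; the root pairs `w x₁ x₄`, `w x₂ x₄`, `w x₃ x₄` flipped by symmetry). [folklore] -/
theorem threshold_pow4_slot_4 (hw0 : ∀ x y, 0 ≤ w x y) (hws : ∀ x y, w x y = w y x) (hS0 : 0 ≤ S) (hS : ∀ x, ∑ y, w x y ≤ S) (x₄ : ι) :
    ∑ x₁, ∑ x₂, ∑ x₃, ∑ x₅, (min (max (w x₁ x₂) (max (w x₁ x₃) (max (w x₁ x₄) (w x₁ x₅)))) (min (max (w x₁ x₃) (max (w x₂ x₃) (max (w x₁ x₄) (max (w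
        x₂ x₄) (max (w x₁ x₅) (w x₂ x₅)))))) (min (max (w x₁ x₂) (max (w x₂ x₃) (max (w x₁ x₄) (max (w x₃ x₄) (max (w x₁ x₅) (w x₃ x₅)))))) (min (max
        (w x₁ x₂) (max (w x₂ x₄) (max (w x₁ x₃) (max (w x₃ x₄) (max (w x₁ x₅) (w x₄ x₅)))))) (min (max (w x₁ x₂) (max (w x₂ x₅) (max (w x₁ x₃) (max
        (w x₃ x₅) (max (w x₁ x₄) (w x₄ x₅)))))) (min (max (w x₁ x₄) (max (w x₂ x₄) (max (w x₃ x₄) (max (w x₁ x₅) (max (w x₂ x₅) (w x₃ x₅)))))) (min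
        (max (w x₁ x₃) (max (w x₂ x₃) (max (w x₃ x₄) (max (w x₁ x₅) (max (w x₂ x₅) (w x₄ x₅)))))) (min (max (w x₁ x₃) (max (w x₂ x₃) (max (w x₃ x₅)
        (max (w x₁ x₄) (max (w x₂ x₄) (w x₄ x₅)))))) (min (max (w x₁ x₂) (max (w x₂ x₃) (max (w x₂ x₄) (max (w x₁ x₅) (max (w x₃ x₅) (w x₄ x₅))))))
        (min (max (w x₁ x₂) (max (w x₂ x₃) (max (w x₂ x₅) (max (w x₁ x₄) (max (w x₃ x₄) (w x₄ x₅)))))) (min (max (w x₁ x₂) (max (w x₂ x₄) (max (w x₂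
        x₅) (max (w x₁ x₃) (max (w x₃ x₄) (w x₃ x₅)))))) (min (max (w x₁ x₅) (max (w x₂ x₅) (max (w x₃ x₅) (w x₄ x₅)))) (min (max (w x₁ x₄) (max (w
        x₂ x₄) (max (w x₃ x₄) (w x₄ x₅)))) (min (max (w x₁ x₃) (max (w x₂ x₃) (max (w x₃ x₄) (w x₃ x₅)))) (max (w x₁ x₂) (max (w x₂ x₃) (max (w x₂
        x₄) (w x₂ x₅)))))))))))))))))) ^ 4 ≤ 576 * S ^ 4 := by
  refine le_trans (Finset.sum_le_sum fun x₁ _ => Finset.sum_le_sum fun x₂ _ => Finset.sum_le_sum fun x₃ _ => Finset.sum_le_sum fun x₅ _ =>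
    minmax_pow4_le_greedy_4 (q12 := w x₁ x₂) (q13 := w x₁ x₃) (q14 := w x₁ x₄) (q15 := w x₁ x₅) (q23 := w x₂ x₃) (q24 := w x₂ x₄) (q25 := w x₂ x₅)
        (q34 := w x₃ x₄) (q35 := w x₃ x₅) (q45 := w x₄ x₅)
      (hw0 _ _) (hw0 _ _) (hw0 _ _) (hw0 _ _) (hw0 _ _) (hw0 _ _) (hw0 _ _) (hw0 _ _) (hw0 _ _) (hw0 _ _)) ?_
  refine le_trans (le_of_eq ?_) (l_1 hw0 hS0 hS (colsum_of_symm hws hS) x₄)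
  refine Finset.sum_congr rfl fun x₁ _ => Finset.sum_congr rfl fun x₂ _ => Finset.sum_congr rfl fun x₃ _ => Finset.sum_congr rfl fun x₅ _ => ?_
  rw [hws x₁ x₄, hws x₂ x₄, hws x₃ x₄]

/-- **SLOT `5`: `Σ_{x₁,x₂,x₃,x₄} t⋆(w;x₁,…,x₅)⁴ ≤ 576·S⁴`** uniformly in `x₅` and the volume ((539) `minmax_pow4_le_greedy_5`, then
(538) `l_1` rooted at `x₅`; the root pairs `w x₁ x₅`, `w x₂ x₅`, `w x₃ x₅`, `w x₄ x₅` flipped by symmetry). [folklore] -/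
theorem threshold_pow4_slot_5 (hw0 : ∀ x y, 0 ≤ w x y) (hws : ∀ x y, w x y = w y x) (hS0 : 0 ≤ S) (hS : ∀ x, ∑ y, w x y ≤ S) (x₅ : ι) :
    ∑ x₁, ∑ x₂, ∑ x₃, ∑ x₄, (min (max (w x₁ x₂) (max (w x₁ x₃) (max (w x₁ x₄) (w x₁ x₅)))) (min (max (w x₁ x₃) (max (w x₂ x₃) (max (w x₁ x₄) (max (w
        x₂ x₄) (max (w x₁ x₅) (w x₂ x₅)))))) (min (max (w x₁ x₂) (max (w x₂ x₃) (max (w x₁ x₄) (max (w x₃ x₄) (max (w x₁ x₅) (w x₃ x₅)))))) (min (max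
        (w x₁ x₂) (max (w x₂ x₄) (max (w x₁ x₃) (max (w x₃ x₄) (max (w x₁ x₅) (w x₄ x₅)))))) (min (max (w x₁ x₂) (max (w x₂ x₅) (max (w x₁ x₃) (max
        (w x₃ x₅) (max (w x₁ x₄) (w x₄ x₅)))))) (min (max (w x₁ x₄) (max (w x₂ x₄) (max (w x₃ x₄) (max (w x₁ x₅) (max (w x₂ x₅) (w x₃ x₅)))))) (min
        (max (w x₁ x₃) (max (w x₂ x₃) (max (w x₃ x₄) (max (w x₁ x₅) (max (w x₂ x₅) (w x₄ x₅)))))) (min (max (w x₁ x₃) (max (w x₂ x₃) (max (w x₃ x₅)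
        (max (w x₁ x₄) (max (w x₂ x₄) (w x₄ x₅)))))) (min (max (w x₁ x₂) (max (w x₂ x₃) (max (w x₂ x₄) (max (w x₁ x₅) (max (w x₃ x₅) (w x₄ x₅))))))
        (min (max (w x₁ x₂) (max (w x₂ x₃) (max (w x₂ x₅) (max (w x₁ x₄) (max (w x₃ x₄) (w x₄ x₅)))))) (min (max (w x₁ x₂) (max (w x₂ x₄) (max (w x₂
        x₅) (max (w x₁ x₃) (max (w x₃ x₄) (w x₃ x₅)))))) (min (max (w x₁ x₅) (max (w x₂ x₅) (max (w x₃ x₅) (w x₄ x₅)))) (min (max (w x₁ x₄) (max (w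
        x₂ x₄) (max (w x₃ x₄) (w x₄ x₅)))) (min (max (w x₁ x₃) (max (w x₂ x₃) (max (w x₃ x₄) (w x₃ x₅)))) (max (w x₁ x₂) (max (w x₂ x₃) (max (w x₂
        x₄) (w x₂ x₅)))))))))))))))))) ^ 4 ≤ 576 * S ^ 4 := by
  refine le_trans (Finset.sum_le_sum fun x₁ _ => Finset.sum_le_sum fun x₂ _ => Finset.sum_le_sum fun x₃ _ => Finset.sum_le_sum fun x₄ _ =>
    minmax_pow4_le_greedy_5 (q12 := w x₁ x₂) (q13 := w x₁ x₃) (q14 := w x₁ x₄) (q15 := w x₁ x₅) (q23 := w x₂ x₃) (q24 := w x₂ x₄) (q25 := w x₂ x₅)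
        (q34 := w x₃ x₄) (q35 := w x₃ x₅) (q45 := w x₄ x₅)
      (hw0 _ _) (hw0 _ _) (hw0 _ _) (hw0 _ _) (hw0 _ _) (hw0 _ _) (hw0 _ _) (hw0 _ _) (hw0 _ _) (hw0 _ _)) ?_
  refine le_trans (le_of_eq ?_) (l_1 hw0 hS0 hS (colsum_of_symm hws hS) x₅)
  refine Finset.sum_congr rfl fun x₁ _ => Finset.sum_congr rfl fun x₂ _ => Finset.sum_congr rfl fun x₃ _ => Finset.sum_congr rfl fun x₄ _ => ?_
  rw [hws x₁ x₅, hws x₂ x₅, hws x₃ x₅, hws x₄ x₅]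

end Slots

/-! ## §3. Toy -/

/-- Toy (§1 on a one-point type with `w = 1`, `S = 1`). -/
example : ∑ _x : Unit, (fun _ _ : Unit => (1 : ℝ)) () () ≤ 1 :=
  colsum_of_symm (w := fun _ _ : Unit => (1 : ℝ)) (fun _ _ => rfl) (fun _ => by simp) ()

end Summit.QuantumFields.BalabanUV.T4Continuum.NE7b.SupFivePointThresholdSlotSums
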